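import Literature.MathematicalPhysics.QuantumFieldTheory.Balaban1983to89.B11Eq174Chart
import Literature.MathematicalPhysics.QuantumFieldTheory.Balaban1983to89.T4FixedPointResponse

/-!
# `Balaban1983to89.B11Eq175SolutionLipschitzLetters` — T. Bałaban, *The variational problem and background fields in renormalization group
# method for lattice gauge theories*, Commun. Math. Phys. **102** (1985) 277–309 [Balaban1985Variational] Prop. 6 (116)–(121) p. 295,
# (175) p. 305, (47)/(50) pp. 285–286: THE SELECTED SOLUTION `solA` OF (116)/(175) RESPONDS LIPSCHITZ-CONTINUOUSLY TO ALL THREE OPERATOR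
# LETTERS `(𝒢, Λ, W)` AT ONCE AND TO THE DATA `(J, 𝔄)` — the tree's fixed-point perturbation lemmas (`T4FixedPointResponse` §4–§5, stated over
# `mapT` fixed points) READ AT THE LEVEL OF lit-balaban's object `solA`; in particular the Sect. C solution of (50) is Lipschitz in BOTH its
# letters `(H, C)`

statement-level skeleton of published theorems with citation tags; proofs where landed; nothing here is a claim about the Yang–Mills mass gap

PDF held: `paper:balaban1985-cmp102-variational-background` (journal page = PDF page + 276); p. 295 read first-hand on the text layer by this
seat (2026-08-22, p0019 L17–33): *«Next, let us investigate when the transformation (116) is contractive. A difference of its values at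
configurations A₁, A₂ can be written as [(119)] … Thus the transformation is contractive if [(121)] … Proposition 6. There exists a positive,
absolute constant a₄ such, that for ε₄ ≤ a₄ and ε₁ satisfying 2B₀C₁B₃ε₁ ≤ ε₄ Eq. (111) has exactly one solution in the space (115).»*
WHAT IS PRINTED is existence, uniqueness and analyticity in `𝔄` (p. 296); the LIPSCHITZ dependence of the solution on the operator letters and
on the data is NOT printed — it is the quantitative half of the same contraction argument ((120)), which the tree holds as
`T4FixedPointResponse.norm_solution_sub_le_general` ∕ `_background` ∕ `_data` (pub-balaban NE3 lineage; [folklore]).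

WHY THIS FILE (cell context, pub-balaban NE9).  The NE9 chain's chart of the curve species `cur U` is `chartHB 𝔊(U) Λ W 0 T ε₄ H₁(U)` with the
T-slot `T = (A′ ↦ A′ + solA H 0 C 0 ε_C A′)` ((47); `B11Eq90V0GroupComposed.T47`, `NE9B11ChartAnalytic.chart47_spec`).  The OWNER t4-ne9-p1
g81's «continuity of the chart in the background» (journal INTENT-3 l.41220 ∕ A-3 l.41291, `B11Eq120SolutionLipschitz` v1.1) treats the `𝒢`-slot
(`W`, `Λ` FIXED, `‖𝒢₁ − 𝒢₂‖ ≤ δ`) and the datum `𝔄`.  In the chain, however, `W = W80(U)` and the T-slot's letters `H = Hop … (k_{H(U)})`,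
`C = Cc … U` ALL move with the background.  THIS FILE supplies the missing slots, with NO new proof: the defect form of `T4FixedPointResponse` §5
(arbitrary second triple `(𝒢₂, Λ₂, W₂)`) read at `solA`, its Sect. C specialisation (both letters `(H, C)`), and the joint data response.
Nothing of the OWNER's file is restated: his `norm_solA_sub_solA_le` is the `Λ₁ = Λ₂`, `W₁ = W₂` case of §1 with the two `𝒢`-defects bounded
by `δ(j + C₄(ε₄ + a)²)`; his `_datum` lemmas are not repeated here.

WHAT IS PROVED (sorry-free; no definition; no `Prop` placeholder; no inequality of the paper asserted).
* §0 **`norm_solA_sub_le_of_defect`** — the A-POSTERIORI form: under `R : Regime 𝒢 Λ W B₀ θ C₄ a₃ j a ε₄`, for ANY `X` in the ball `‖X‖ ≤ ε₄` (a second chart's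
  value, a transported solution, a guess): `‖𝒜 − X‖ ≤ ‖T X − X‖∕(1 − q)`, `T = mapT 𝒢 Λ W J 𝔄` — the distance to the solution is the DEFECT of `X` under the
  contraction (`T4FixedPointResponse.norm_sub_le_of_fixedPoints` with the constant second map); every later bound is this one with the defect expanded.
* §1 **`norm_solA_sub_solA_le_letters`** — `R₁ : Regime 𝒢₁ Λ₁ W₁ B₀ θ C₄ a₃ j a ε₄` and ANY second triple with `R₂ : Regime 𝒢₂ Λ₂ W₂ B₀′ θ′ C₄′ a₃′ j′ a′ ε₄`
  (same ball `ε₄`), common data `‖J‖ ≤ min j j′`, `‖𝔄‖ < min a a′`: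
  `‖𝒜₁ − 𝒜₂‖ ≤ (‖(𝒢₁ − 𝒢₂)J‖ + ‖(Λ₁ − Λ₂)(𝒜₂ + 𝔄)‖ + ‖(𝒢₁ − 𝒢₂)(W₂(𝒜₂ + 𝔄))‖ + B₀‖W₁(𝒜₂ + 𝔄) − W₂(𝒜₂ + 𝔄)‖)∕(1 − q₁)`,
  `q₁ = θ + 4B₀C₄(ε₄ + a)` — every defect evaluated AT the second solution, whose argument has norm `< ε₄ + a′` (also returned).
* §2 **`norm_solA_sectC_sub_le_letters`** — the T-slot twin in BOTH letters: `Regime H₁ 0 C₁ b 0 C₂ c₄ 0 a_C ε_C`, `Regime H₂ 0 C₂′ b′ 0 C₂″ c₄′ 0 a_C′ ε_C`,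
  `‖A′‖ < min a_C a_C′`: `‖𝒜₁(A′) − 𝒜₂(A′)‖ ≤ (‖(H₁ − H₂)(C₂′(𝒜₂ + A′))‖ + b‖C₁(𝒜₂ + A′) − C₂′(𝒜₂ + A′)‖)∕(1 − 4bC₂(ε_C + a_C))`; the same
  number bounds `‖(A′ + 𝒜₁(A′)) − (A′ + 𝒜₂(A′))‖` (the map (47) at two backgrounds, one argument).
* §3 **`norm_solA_sub_solA_le_data`** — one triple, two data `(J₁, 𝔄₁)`, `(J₂, 𝔄₂)`: `(‖𝒢(J₁ − J₂)‖ + q‖𝔄₁ − 𝔄₂‖)∕(1 − q)`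
  (`T4FixedPointResponse.norm_solution_sub_le_data` at `solA`); **`norm_solA_sub_solA_le_current`** (`𝔄₁ = 𝔄₂`: `≤ B₀‖J₁ − J₂‖∕(1 − q)`).
HONEST SCOPE.  (i) [folklore] contraction-mapping perturbation, re-used BY NAME from the tree (`T4FixedPointResponse`, NE3 lineage); the Lipschitz
statements are NOT in print.  (ii) Abstract complex normed spaces as in `B11Eq174Chart`; the background-dependence of the CARRIERS (`Space115 … (∇_U)`)
is NOT treated.  (iii) NOT summit progress (cell pub-balaban: NE9 NOT PRINTED ∕ NOT PROVED; «NE9 ⇐ the named binders»; spine PROVED 0∕9; rung (B)+1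
finite T⁴ — NOT infinite volume, NOT mass gap, NOT Clay; HONEST DEPENDENCY: continuum YM on T⁴ ⇐ BetaPertH ∧ nine spine estimates (0/9 proved);
BetaPertH ⇐ (D1) ∧ (D4) ∧ CAP+tail; G-an2-4 gates asym, D1 and NE2/3/4).  Filed by the NE9 leaf seat `b2b-balaban-t4-ne9-formalise-leaf-01` (gen 75);
NEW file; imports `B11Eq174Chart`, `T4FixedPointResponse` ONLY; nothing modified.  Net new unproved facts: 0.
-/

noncomputable section

namespace Literature.MathematicalPhysics.QuantumFieldTheory.Balaban1983to89.B11Eq175SolutionLipschitzLetters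

open Metric Set
open B13Contraction113 (QuadAnalytic)
open B11Prop6Scheme (mapT norm_arg_lt lipschitz_120)
open B11Eq174Chart (Regime solA)
open T4FixedPointResponse (norm_sub_le_of_fixedPoints norm_solution_sub_le_data norm_solution_sub_le_general mapT_sub_mapT_background)

variable {𝒴 𝒵 : Type*} [NormedAddCommGroup 𝒴] [NormedSpace ℂ 𝒴] [NormedAddCommGroup 𝒵] [NormedSpace ℂ 𝒵] [CompleteSpace 𝒴]

/-! ## §0 The a-posteriori bound: distance to the solution = defect under the contraction -/

/-- **A-POSTERIORI BOUND**: under the regime (117)–(121) with data `‖J‖ ≤ j`, `‖𝔄‖ < a`, for ANY point `X` of the ball `‖X‖ ≤ ε₄`: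
`‖𝒜 − X‖ ≤ ‖T X − X‖∕(1 − q)`, `T = mapT 𝒢 Λ W J 𝔄` the map (116)∕(143), `q = θ + 4B₀C₄(ε₄ + a) < 1` its contraction constant ((120)) — the fixed-point
perturbation lemma with the constant second map (`T4FixedPointResponse.norm_sub_le_of_fixedPoints`, `B11Prop6Scheme.lipschitz_120`).  `X` may be anything:
the solution of a second regime, on other letters or data, or a value transported from another carrier — only its defect under THIS `T` is needed.
[cite: Balaban1985Variational, Prop. 6 (116)–(121) p.295] -/
theorem norm_solA_sub_le_of_defect {𝒢 : 𝒵 →L[ℂ] 𝒴} {Λ : 𝒴 →L[ℂ] 𝒴} {W : 𝒴 → 𝒵} {B₀ θ C₄ a₃ j a ε₄ : ℝ}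
    (R : Regime 𝒢 Λ W B₀ θ C₄ a₃ j a ε₄) {J : 𝒵} {𝔄 : 𝒴} (hJ : ‖J‖ ≤ j) (h𝔄 : ‖𝔄‖ < a) {X : 𝒴} (hX : ‖X‖ ≤ ε₄) :
    ‖solA 𝒢 Λ W J ε₄ 𝔄 - X‖ ≤ ‖mapT 𝒢 Λ W J 𝔄 X - X‖ / (1 - (θ + 4 * B₀ * C₄ * (ε₄ + a))) :=
  norm_sub_le_of_fixedPoints (T₂ := fun _ => X) R.contr
    (fun _ _ hx hy => lipschitz_120 (J := J) R.norm_G R.norm_L R.quad R.B₀_nonneg R.C₄_nonneg h𝔄 R.ε₄_nonneg R.dom hx hy)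
    (R.solA_mem hJ h𝔄).1 hX (R.solA_mem hJ h𝔄).2 rfl

/-! ## §1 The selected solution responds to all three operator letters `(𝒢, Λ, W)` -/

/-- **`𝒜` IS LIPSCHITZ IN THE LETTERS `(𝒢, Λ, W)`, DEFECT FORM**: for a regime `R₁` of `(𝒢₁, Λ₁, W₁)` and ANY second triple `(𝒢₂, Λ₂, W₂)` in a
regime `R₂` on the same ball `‖X‖ ≤ ε₄`, common data `‖J‖ ≤ min j j′`, `‖𝔄‖ < min a a′`:
`‖𝒜₁ − 𝒜₂‖ ≤ (‖(𝒢₁ − 𝒢₂)J‖ + ‖(Λ₁ − Λ₂)(𝒜₂ + 𝔄)‖ + ‖(𝒢₁ − 𝒢₂)(W₂(𝒜₂ + 𝔄))‖ + B₀‖W₁(𝒜₂ + 𝔄) − W₂(𝒜₂ + 𝔄)‖)∕(1 − q₁)`, `q₁ = θ + 4B₀C₄(ε₄ + a)`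
— the contraction estimate (120) of `T₁` plus the defect `T₁𝒜₂ − T₂𝒜₂` (`T4FixedPointResponse.norm_solution_sub_le_general` +
`mapT_sub_mapT_background`, read at `solA` through `Regime.solA_mem`); the argument `𝒜₂ + 𝔄` has norm `< ε₄ + a′` (returned, for bounding the
`W`-defect by a Lipschitz∕sup letter of `W₁ − W₂` on that ball).  Not printed (print: «exactly one solution», Prop. 6).
[cite: Balaban1985Variational, Prop. 6 (116)–(121) p.295, (175) p.305] -/
theorem norm_solA_sub_solA_le_letters {𝒢₁ 𝒢₂ : 𝒵 →L[ℂ] 𝒴} {Λ₁ Λ₂ : 𝒴 →L[ℂ] 𝒴} {W₁ W₂ : 𝒴 → 𝒵}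
    {B₀ θ C₄ a₃ j a B₀' θ' C₄' a₃' j' a' ε₄ : ℝ} (R₁ : Regime 𝒢₁ Λ₁ W₁ B₀ θ C₄ a₃ j a ε₄) (R₂ : Regime 𝒢₂ Λ₂ W₂ B₀' θ' C₄' a₃' j' a' ε₄)
    {J : 𝒵} {𝔄 : 𝒴} (hJ : ‖J‖ ≤ j) (hJ' : ‖J‖ ≤ j') (h𝔄 : ‖𝔄‖ < a) (h𝔄' : ‖𝔄‖ < a') :
    ‖solA 𝒢₁ Λ₁ W₁ J ε₄ 𝔄 - solA 𝒢₂ Λ₂ W₂ J ε₄ 𝔄‖ ≤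
        (‖(𝒢₁ - 𝒢₂) J‖ + ‖(Λ₁ - Λ₂) (solA 𝒢₂ Λ₂ W₂ J ε₄ 𝔄 + 𝔄)‖ + ‖(𝒢₁ - 𝒢₂) (W₂ (solA 𝒢₂ Λ₂ W₂ J ε₄ 𝔄 + 𝔄))‖ +
          B₀ * ‖W₁ (solA 𝒢₂ Λ₂ W₂ J ε₄ 𝔄 + 𝔄) - W₂ (solA 𝒢₂ Λ₂ W₂ J ε₄ 𝔄 + 𝔄)‖) / (1 - (θ + 4 * B₀ * C₄ * (ε₄ + a))) ∧
      ‖solA 𝒢₂ Λ₂ W₂ J ε₄ 𝔄 + 𝔄‖ < ε₄ + a' := by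
  have hm₁ := R₁.solA_mem hJ h𝔄
  have hm₂ := R₂.solA_mem hJ' h𝔄'
  set X₂ := solA 𝒢₂ Λ₂ W₂ J ε₄ 𝔄 with hX₂
  have h := norm_solution_sub_le_general R₁.norm_G R₁.norm_L R₁.quad R₁.B₀_nonneg R₁.C₄_nonneg h𝔄 R₁.ε₄_nonneg R₁.dom R₁.contr
    hm₁.1 hm₂.1 hm₁.2 hm₂.2
  have h1q : 0 < 1 - (θ + 4 * B₀ * C₄ * (ε₄ + a)) := by linarith [R₁.contr]
  refine ⟨h.trans (div_le_div_of_nonneg_right ?_ h1q.le), norm_arg_lt h𝔄' hm₂.1⟩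
  rw [mapT_sub_mapT_background]
  have t4 : ‖𝒢₁ (W₁ (X₂ + 𝔄) - W₂ (X₂ + 𝔄))‖ ≤ B₀ * ‖W₁ (X₂ + 𝔄) - W₂ (X₂ + 𝔄)‖ := R₁.norm_G _
  calc ‖-(𝒢₁ - 𝒢₂) J + (Λ₁ - Λ₂) (X₂ + 𝔄) - (𝒢₁ - 𝒢₂) (W₂ (X₂ + 𝔄)) - 𝒢₁ (W₁ (X₂ + 𝔄) - W₂ (X₂ + 𝔄))‖
      ≤ ‖-(𝒢₁ - 𝒢₂) J + (Λ₁ - Λ₂) (X₂ + 𝔄) - (𝒢₁ - 𝒢₂) (W₂ (X₂ + 𝔄))‖ + ‖𝒢₁ (W₁ (X₂ + 𝔄) - W₂ (X₂ + 𝔄))‖ := norm_sub_le _ _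
    _ ≤ (‖-(𝒢₁ - 𝒢₂) J + (Λ₁ - Λ₂) (X₂ + 𝔄)‖ + ‖(𝒢₁ - 𝒢₂) (W₂ (X₂ + 𝔄))‖) + ‖𝒢₁ (W₁ (X₂ + 𝔄) - W₂ (X₂ + 𝔄))‖ := by
        gcongr; exact norm_sub_le _ _
    _ ≤ ((‖-(𝒢₁ - 𝒢₂) J‖ + ‖(Λ₁ - Λ₂) (X₂ + 𝔄)‖) + ‖(𝒢₁ - 𝒢₂) (W₂ (X₂ + 𝔄))‖) + ‖𝒢₁ (W₁ (X₂ + 𝔄) - W₂ (X₂ + 𝔄))‖ := by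
        gcongr; exact norm_add_le _ _
    _ ≤ _ := by rw [norm_neg]; linarith

/-! ## §2 The Sect. C solution of (50): Lipschitz in BOTH its letters `(H, C)` -/

section SectC

variable {𝒳 : Type*} [NormedAddCommGroup 𝒳] [NormedSpace ℂ 𝒳]

/-- **THE SECT. C SOLUTION IS LIPSCHITZ IN ITS TWO LETTERS `(H, C)`** — two Sect. C regimes `Regime H₁ 0 C₁ b 0 C₂ c₄ 0 a_C ε_C`,
`Regime H₂ 0 C₂′ b′ 0 C₂″ c₄′ 0 a_C′ ε_C` ((50) as the scheme at `(𝒢, Λ, W, J) := (H, 0, C, 0)`) on the same ball `ε_C`, one argument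
`‖A′‖ < min a_C a_C′`: `‖𝒜₁(A′) − 𝒜₂(A′)‖ ≤ (‖(H₁ − H₂)(C₂′(𝒜₂ + A′))‖ + b‖C₁(𝒜₂ + A′) − C₂′(𝒜₂ + A′)‖)∕(1 − 4bC₂(ε_C + a_C))`; the map (47)
`A′ ↦ A = A′ + 𝒜(A′)` at the two backgrounds differs by the same number; the argument `𝒜₂ + A′` has norm `< ε_C + a_C′`.  In the NE9 chain both letters
move with the background (`H = Hop … (k_{H(U)})`, `C = Cc … U`), so both defect terms are live. [cite: Balaban1985Variational, (47)–(50) pp.285–286, Prop. 6 (120) p.295] -/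
theorem norm_solA_sectC_sub_le_letters {H₁ H₂ : 𝒳 →L[ℂ] 𝒴} {C₁ C₂' : 𝒴 → 𝒳} {b C₂ c₄ aC b' C₂'' c₄' aC' εC : ℝ}
    (R₁ : Regime H₁ 0 C₁ b 0 C₂ c₄ 0 aC εC) (R₂ : Regime H₂ 0 C₂' b' 0 C₂'' c₄' 0 aC' εC) {A' : 𝒴} (hA : ‖A'‖ < aC) (hA' : ‖A'‖ < aC') :
    ‖solA H₁ 0 C₁ (0 : 𝒳) εC A' - solA H₂ 0 C₂' (0 : 𝒳) εC A'‖ ≤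
        (‖(H₁ - H₂) (C₂' (solA H₂ 0 C₂' (0 : 𝒳) εC A' + A'))‖ +
          b * ‖C₁ (solA H₂ 0 C₂' (0 : 𝒳) εC A' + A') - C₂' (solA H₂ 0 C₂' (0 : 𝒳) εC A' + A')‖) / (1 - 4 * b * C₂ * (εC + aC)) ∧
      ‖(A' + solA H₁ 0 C₁ (0 : 𝒳) εC A') - (A' + solA H₂ 0 C₂' (0 : 𝒳) εC A')‖ ≤
        (‖(H₁ - H₂) (C₂' (solA H₂ 0 C₂' (0 : 𝒳) εC A' + A'))‖ +
          b * ‖C₁ (solA H₂ 0 C₂' (0 : 𝒳) εC A' + A') - C₂' (solA H₂ 0 C₂' (0 : 𝒳) εC A' + A')‖) / (1 - 4 * b * C₂ * (εC + aC)) ∧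
      ‖solA H₂ 0 C₂' (0 : 𝒳) εC A' + A'‖ < εC + aC' := by
  have hJ : ‖(0 : 𝒳)‖ ≤ 0 := by rw [norm_zero]
  obtain ⟨h, harg⟩ := norm_solA_sub_solA_le_letters R₁ R₂ hJ hJ hA hA'
  rw [map_zero, norm_zero, zero_add, sub_self, _root_.zero_apply, norm_zero, zero_add, zero_add] at h
  refine ⟨h, ?_, harg⟩
  rwa [add_sub_add_left_eq_sub]

end SectC

/-! ## §3 One triple, two data `(J, 𝔄)` -/

variable {𝒢 : 𝒵 →L[ℂ] 𝒴} {Λ : 𝒴 →L[ℂ] 𝒴} {W : 𝒴 → 𝒵} {B₀ θ C₄ a₃ j a ε₄ : ℝ}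

/-- **`𝒜` IS LIPSCHITZ IN THE DATA `(J, 𝔄)` JOINTLY**: under the regime (117)–(121), for `‖J₁‖, ‖J₂‖ ≤ j` and `‖𝔄₁‖, ‖𝔄₂‖ < a`:
`‖𝒜(J₁, 𝔄₁) − 𝒜(J₂, 𝔄₂)‖ ≤ (‖𝒢(J₁ − J₂)‖ + q‖𝔄₁ − 𝔄₂‖)∕(1 − q)`, `q = θ + 4B₀C₄(ε₄ + a)` — `T4FixedPointResponse.norm_solution_sub_le_data` read at
`solA`.  (The `𝔄`-only case is the OWNER's `B11Eq120SolutionLipschitz.norm_solA_sub_solA_le_datum`, not restated.)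
[cite: Balaban1985Variational, Prop. 6 (116)–(121) p.295, (175) p.305] -/
theorem norm_solA_sub_solA_le_data (R : Regime 𝒢 Λ W B₀ θ C₄ a₃ j a ε₄) {J₁ J₂ : 𝒵} {𝔄₁ 𝔄₂ : 𝒴} (hJ₁ : ‖J₁‖ ≤ j) (hJ₂ : ‖J₂‖ ≤ j)
    (h𝔄₁ : ‖𝔄₁‖ < a) (h𝔄₂ : ‖𝔄₂‖ < a) :
    ‖solA 𝒢 Λ W J₁ ε₄ 𝔄₁ - solA 𝒢 Λ W J₂ ε₄ 𝔄₂‖ ≤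
      (‖𝒢 (J₁ - J₂)‖ + (θ + 4 * B₀ * C₄ * (ε₄ + a)) * ‖𝔄₁ - 𝔄₂‖) / (1 - (θ + 4 * B₀ * C₄ * (ε₄ + a))) :=
  norm_solution_sub_le_data R.norm_G R.norm_L R.quad R.B₀_nonneg R.C₄_nonneg h𝔄₁ h𝔄₂ R.ε₄_nonneg R.dom R.contr
    (R.solA_mem hJ₁ h𝔄₁).1 (R.solA_mem hJ₂ h𝔄₂).1 (R.solA_mem hJ₁ h𝔄₁).2 (R.solA_mem hJ₂ h𝔄₂).2

/-- **`𝒜` IS LIPSCHITZ IN THE CURRENT `J`** (one datum `𝔄`): `‖𝒜(J₁) − 𝒜(J₂)‖ ≤ ‖𝒢(J₁ − J₂)‖∕(1 − q) ≤ B₀‖J₁ − J₂‖∕(1 − q)` — the term `−𝒢J`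
of (116) enters linearly. [cite: Balaban1985Variational, Prop. 6 (116)–(117) p.295] -/
theorem norm_solA_sub_solA_le_current (R : Regime 𝒢 Λ W B₀ θ C₄ a₃ j a ε₄) {J₁ J₂ : 𝒵} {𝔄 : 𝒴} (hJ₁ : ‖J₁‖ ≤ j) (hJ₂ : ‖J₂‖ ≤ j)
    (h𝔄 : ‖𝔄‖ < a) :
    ‖solA 𝒢 Λ W J₁ ε₄ 𝔄 - solA 𝒢 Λ W J₂ ε₄ 𝔄‖ ≤ ‖𝒢 (J₁ - J₂)‖ / (1 - (θ + 4 * B₀ * C₄ * (ε₄ + a))) ∧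
      ‖solA 𝒢 Λ W J₁ ε₄ 𝔄 - solA 𝒢 Λ W J₂ ε₄ 𝔄‖ ≤ B₀ * ‖J₁ - J₂‖ / (1 - (θ + 4 * B₀ * C₄ * (ε₄ + a))) := by
  have h := norm_solA_sub_solA_le_data R hJ₁ hJ₂ h𝔄 h𝔄
  rw [sub_self, norm_zero, mul_zero, add_zero] at h
  have h1q : 0 < 1 - (θ + 4 * B₀ * C₄ * (ε₄ + a)) := by linarith [R.contr]
  exact ⟨h, h.trans (div_le_div_of_nonneg_right (R.norm_G _) h1q.le)⟩

end Literature.MathematicalPhysics.QuantumFieldTheory.Balaban1983to89.B11Eq175SolutionLipschitzLetters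

end
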